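import Mathlib
import Summits.KontsevichZagierPeriods.Zeta5Search.BrickPhiCoeff
import Summits.KontsevichZagierPeriods.Zeta5Search.BrickPhiSymmetry

/-!
# BrickWeightLocality — THEOREM 7 LEMMA 4: the weight `u(j) = (Φ_{n,p}(−j) − 1)/p³` is a `p`-adic integer,
reflection-invariant, and DIGIT-LOCAL to every depth: `u(j') ≡ u(j) (mod p^e)` whenever `p^e ∣ j − j'`
(cell zeta5-irr)

HONEST FRAMING: systematic search; no irrationality claim unless certified. INSTRUMENT lemmas of the ζ(5)
census cell zeta5-irr (HOME `run/shared/lean/pub/zeta5-irr/`; memo `zi-p2/probes/B8/thm7/THEOREM7.md` §2 LEMMA 4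
«(i) u(j) ∈ ℤ_(p) [(A2)]; (ii) u(n−j) = u(j) [(A5)]; (iii) DIGIT-LOCALITY: u(j*) ≡ u(j) (mod p^e) whenever j* ≡ j
(mod p^e)»; `zi-p2/probes/B8/thm8/THEOREM8.md` Q-0). Nothing here is about ζ(5); no irrationality content; filing
moves no rung. Filed by the engine seat zi-eng (g9). DESIGN: zi-p2 proves (iii) through the block-polynomial product
(4.1); here (iii) is read off the TAYLOR EXPANSION at `−j` instead: `Φ(−j + T) = N_j(T)/D_j(T) = 1 + p³G(T)` with
`G ∈ ℤ_(p)⟦T⟧` (`BrickPhiCoeff.phiSeries_eq_one_add` = THEOREM 2 (ii) coefficientwise), so the polynomial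
`R := N_j − Φ(−j)·D_j = p³·D_j·(G − G(0))` has coefficients in `p³ℤ_(p)` and no constant term, whence
`Φ(−j') − Φ(−j) = R(j−j')/D_j(j−j') ∈ (j − j')·p³ℤ_(p)` (`D_j(j − j') = D_{j'}(0)` is a unit).

## The statements (`p ≥ 5` prime, `2B ≤ A`, `j, j' ∈ ℤ`)

* `phiWeight A B p n j := (phiCoeff A B p n j 0 − 1)/p³ = (Φ_{n,p}(−j) − 1)/p³` — zi-p2's `u_n(j)`;
* `padicValuation_phiWeight_le` (i): `u(j) ∈ ℤ_(p)`; `phiWeight_reflect` (ii): `u(n − j) = u(j)` (`j ≤ n`);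
* **`padicValuation_brickPhi_sub_le`**: `v(Φ(−j') − Φ(−j)) ≤ exp(−(e+3))` for `p^e ∣ j − j'`;
* **`padicValuation_phiWeight_sub_le`** (iii): `v(u(j') − u(j)) ≤ exp(−e)` for `p^e ∣ j − j'`.
-/

namespace Summit.KontsevichZagierPeriods.Zeta5Search.BrickWeightLocality

open Finset Nat Polynomial WithZero
open Summit.KontsevichZagierPeriods.Zeta5Search.BrickKernelFrobenius (brickPhi)
open Summit.KontsevichZagierPeriods.Zeta5Search.BrickPhiTaylor (phiNum phiDen brickPhi_neg_add_eq
  not_dvd_phiDen_coeff_zero)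
open Summit.KontsevichZagierPeriods.Zeta5Search.BrickLaurent (expandAt phiSeries phiCoeff phiCoeff_zero
  aeval_eq_eval_map eval_phiDen_zero_ne_zero)
open Summit.KontsevichZagierPeriods.Zeta5Search.ScaledSeries (IsSlopeInt)
open Summit.KontsevichZagierPeriods.Zeta5Search.BrickPhiCoeff (phiSeries_eq_one_add
  padicValuation_phiCoeff_zero_sub_one_le isSlopeInt_coe_map_int)
open Summit.KontsevichZagierPeriods.Zeta5Search.BrickPhiSymmetry (brickPhi_neg_sub_natCast)

noncomputable section

variable {p : ℕ} [Fact p.Prime]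

/-- **zi-p2's weight** `u_n(j) = (Φ_{n,p}(−j) − 1)/p³` (`Φ(−j) = φ_0 = phiCoeff … j 0`). -/
def phiWeight (A B p n : ℕ) (j : ℤ) : ℚ := (phiCoeff A B p n j 0 - 1) / (p : ℚ) ^ 3

/-- **LEMMA 4 (i)**: `u(j) ∈ ℤ_(p)` (`p ≥ 5`, `2B ≤ A`). -/
theorem padicValuation_phiWeight_le (hp3 : 3 < p) {A B : ℕ} (hAB : 2 * B ≤ A) (n : ℕ) (j : ℤ) :
    Rat.padicValuation p (phiWeight A B p n j) ≤ 1 := by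
  rw [phiWeight, map_div₀, map_pow, Rat.padicValuation_self, ← exp_nsmul, div_eq_mul_inv, ← exp_neg]
  calc _ ≤ exp (-3) * exp (-(3 • (-1 : ℤ))) := mul_le_mul' (padicValuation_phiCoeff_zero_sub_one_le hp3 hAB n j) le_rfl
    _ = 1 := by rw [← exp_add, ← exp_zero]; norm_num

/-- **LEMMA 4 (ii)**: `u(n − j) = u(j)` for `j ≤ n` (reflection `Φ(−(n−j)) = Φ(−j)`, odd `p`). -/
theorem phiWeight_reflect (hp2 : p ≠ 2) (A B : ℕ) {n j : ℕ} (hj : j ≤ n) :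
    phiWeight A B p n ((n - j : ℕ) : ℤ) = phiWeight A B p n (j : ℤ) := by
  have hp : p.Prime := Fact.out
  rw [phiWeight, phiWeight, phiCoeff_zero hp hp2, phiCoeff_zero hp hp2, Int.cast_natCast, Int.cast_natCast,
    brickPhi_neg_sub_natCast (hp.odd_of_ne_two hp2) A B hj]

/-! ## LEMMA 4 (iii): digit-locality from the Taylor expansion -/

omit [Fact p.Prime] in
/-- The denominators at two centres: `D_j(j − j') = D_{j'}(0)` (both are `∏_{p∤m≤np}(m − j'p)^A`). -/
theorem eval_phiDen_shift (A n : ℕ) (j j' : ℤ) :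
    (phiDen A p n j).eval (j - j') = (phiDen A p n j').eval 0 := by
  unfold phiDen
  simp only [eval_pow, eval_prod, eval_add, eval_mul, eval_C, eval_X, mul_zero, add_zero]
  exact congrArg (· ^ A) (Finset.prod_congr rfl fun m _ => by ring)

/-- `D_j(j − j')` is a `p`-adic unit (`p ≥ 5`). -/
theorem padicValuation_phiDen_eval_shift (hp3 : 3 < p) (A n : ℕ) (j j' : ℤ) :
    Rat.padicValuation p (((phiDen A p n j).map (Int.castRingHom ℚ)).eval ((j : ℚ) - j')) = 1 := by
  have hp : p.Prime := Fact.out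
  rw [← Int.cast_sub, eval_intCast_map, eq_intCast, Int.cast_id, eval_phiDen_shift, Rat.padicValuation_cast,
    Int.padicValuation_eq_one_iff, ← coeff_zero_eq_eval_zero]
  exact not_dvd_phiDen_coeff_zero hp hp3 A n j'

/-- The Taylor remainder polynomial `R_j := N_j − Φ(−j)·D_j ∈ ℚ[T]` has coefficients in `p³ℤ_(p)` (`p ≥ 5`,
`2B ≤ A`): `R_j = p³·D_j·(G − G(0))` for the `G ∈ ℤ_(p)⟦T⟧` of `Φ(−j+T) = 1 + p³G(T)`. -/
theorem padicValuation_coeff_remainder_le (hp3 : 3 < p) {A B : ℕ} (hAB : 2 * B ≤ A) (n : ℕ) (j : ℤ) (k : ℕ) :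
    Rat.padicValuation p (((phiNum A B p n j).map (Int.castRingHom ℚ) -
      C (phiCoeff A B p n j 0) * (phiDen A p n j).map (Int.castRingHom ℚ)).coeff k) ≤ exp (-3) := by
  have hp : p.Prime := Fact.out
  obtain ⟨G, hG, hGeq⟩ := phiSeries_eq_one_add (p := p) hp3 hAB n j
  set P : ℚ[X] := (phiNum A B p n j).map (Int.castRingHom ℚ) with hP
  set Q : ℚ[X] := (phiDen A p n j).map (Int.castRingHom ℚ) with hQ
  have hQ0 : PowerSeries.constantCoeff (Q : PowerSeries ℚ) ≠ 0 := by
    rw [Polynomial.constantCoeff_coe, coeff_zero_eq_eval_zero]; exact eval_phiDen_zero_ne_zero A p n j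
  -- `↑P = ↑Q · Φ-series`
  have hPQ : (P : PowerSeries ℚ) = (Q : PowerSeries ℚ) * phiSeries A B p n j := by
    rw [phiSeries, expandAt, taylor_zero, taylor_zero, ← hP, ← hQ, mul_left_comm, PowerSeries.mul_inv_cancel _ hQ0,
      mul_one]
  have hφ0 : phiCoeff A B p n j 0 = 1 + (p : ℚ) ^ 3 * PowerSeries.coeff 0 G := by
    rw [phiCoeff, hGeq, map_add, PowerSeries.coeff_one, if_pos rfl, PowerSeries.coeff_C_mul]
  -- the remainder as a power series: `p³ · Q · (G − G(0))`
  have hR : (((P - C (phiCoeff A B p n j 0) * Q : ℚ[X])) : PowerSeries ℚ) =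
      PowerSeries.C ((p : ℚ) ^ 3) * ((Q : PowerSeries ℚ) * (G - PowerSeries.C (PowerSeries.coeff 0 G))) := by
    rw [Polynomial.coe_sub, Polynomial.coe_mul, Polynomial.coe_C, hPQ, hGeq, hφ0]
    simp only [map_add, map_mul, map_one, map_pow]
    ring
  rw [← Polynomial.coeff_coe, hR, PowerSeries.coeff_C_mul, map_mul, map_pow, Rat.padicValuation_self, ← exp_nsmul,
    PowerSeries.coeff_mul]
  have hsum : Rat.padicValuation p (∑ x ∈ antidiagonal k, PowerSeries.coeff x.1 (Q : PowerSeries ℚ) *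
      PowerSeries.coeff x.2 (G - PowerSeries.C (PowerSeries.coeff 0 G))) ≤ 1 := by
    refine Valuation.map_sum_le _ fun x _ => ?_
    rw [map_mul]
    refine mul_le_one' ?_ ?_
    · have := isSlopeInt_coe_map_int (p := p) (phiDen A p n j) x.1
      rwa [zero_mul, zero_add, exp_zero] at this
    · rw [map_sub, PowerSeries.coeff_C]
      split_ifs with h
      · rw [h, sub_self, map_zero]; exact _root_.zero_le
      · rw [sub_zero]; have := hG x.2; rwa [zero_mul, zero_add, exp_zero] at this
  calc _ ≤ exp (3 • (-1 : ℤ)) * 1 := mul_le_mul' le_rfl hsum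
    _ = exp (-3) := by rw [mul_one, nsmul_eq_mul]; norm_num

/-- **`v(Φ(−j') − Φ(−j)) ≤ exp(−(e+3))` whenever `p^e ∣ j − j'`** (`p ≥ 5`, `2B ≤ A`; `j, j' ∈ ℤ`): the Taylor
expansion at `−j` evaluated at `T = j − j'`. -/
theorem padicValuation_brickPhi_sub_le (hp3 : 3 < p) {A B : ℕ} (hAB : 2 * B ≤ A) (n : ℕ) {j j' : ℤ} {e : ℕ}
    (he : (p : ℤ) ^ e ∣ j - j') :
    Rat.padicValuation p (brickPhi A B p n (-(j' : ℚ)) - brickPhi A B p n (-(j : ℚ))) ≤ exp (-((e + 3 : ℕ) : ℤ)) := by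
  have hp : p.Prime := Fact.out
  have hp2 : p ≠ 2 := by omega
  set P : ℚ[X] := (phiNum A B p n j).map (Int.castRingHom ℚ) with hP
  set Q : ℚ[X] := (phiDen A p n j).map (Int.castRingHom ℚ) with hQ
  set T₀ : ℚ := (j : ℚ) - j' with hT₀
  set R : ℚ[X] := P - C (phiCoeff A B p n j 0) * Q with hRdef
  have hQT : Rat.padicValuation p (Q.eval T₀) = 1 := padicValuation_phiDen_eval_shift hp3 A n j j'
  have hQT0 : Q.eval T₀ ≠ 0 := fun h => by rw [h, map_zero] at hQT; exact zero_ne_one hQT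
  -- `Φ(−j') = P(T₀)/Q(T₀)`, `Φ(−j) = φ₀`
  have h1 : brickPhi A B p n (-(j' : ℚ)) = P.eval T₀ / Q.eval T₀ := by
    rw [show (-(j' : ℚ)) = -(j : ℚ) + T₀ by rw [hT₀]; ring, brickPhi_neg_add_eq hp hp2, aeval_eq_eval_map,
      aeval_eq_eval_map]
  have h2 : brickPhi A B p n (-(j : ℚ)) = phiCoeff A B p n j 0 := (phiCoeff_zero hp hp2 A B n j).symm
  -- `R(0) = 0`, so `R = X·divX R`
  have hR0 : R.coeff 0 = 0 := by
    rw [hRdef, coeff_sub, coeff_C_mul, coeff_zero_eq_eval_zero, coeff_zero_eq_eval_zero, phiCoeff, phiSeries,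
      BrickLaurent.coeff_zero_expandAt, ← hP, ← hQ, div_mul_cancel₀ _ (eval_phiDen_zero_ne_zero A p n j), sub_self]
  have hRX : R = X * divX R := by
    conv_lhs => rw [← X_mul_divX_add R, hR0, map_zero, add_zero]
  have hdiff : brickPhi A B p n (-(j' : ℚ)) - brickPhi A B p n (-(j : ℚ)) = T₀ * (divX R).eval T₀ / Q.eval T₀ := by
    rw [h1, h2, eq_div_iff hQT0, sub_mul, div_mul_cancel₀ _ hQT0]
    have : R.eval T₀ = T₀ * (divX R).eval T₀ := by
      conv_lhs => rw [hRX]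
      rw [eval_mul, eval_X]
    rw [← this, hRdef, eval_sub, eval_mul, eval_C]
  -- valuations
  have hT : Rat.padicValuation p T₀ ≤ exp (-(e : ℤ)) := by
    obtain ⟨c, hc⟩ := he
    rw [hT₀, ← Int.cast_sub, hc, Int.cast_mul, Int.cast_pow, Int.cast_natCast, map_mul, map_pow,
      Rat.padicValuation_self, ← exp_nsmul, nsmul_eq_mul, mul_neg_one, Rat.padicValuation_cast]
    calc _ ≤ exp (-(e : ℤ)) * 1 := mul_le_mul' le_rfl (Int.padicValuation_le_one _ _)
      _ = _ := mul_one _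
  have hT1 : Rat.padicValuation p T₀ ≤ 1 := hT.trans (by rw [← exp_zero, exp_le_exp]; omega)
  have hD : Rat.padicValuation p ((divX R).eval T₀) ≤ exp (-3) := by
    rw [eval_eq_sum_range]
    refine Valuation.map_sum_le _ fun k _ => ?_
    rw [map_mul, map_pow, coeff_divX]
    calc _ ≤ exp (-3) * 1 ^ k :=
          mul_le_mul' (padicValuation_coeff_remainder_le hp3 hAB n j (k + 1)) (pow_le_pow_left' hT1 k)
      _ = _ := by rw [one_pow, mul_one]
  rw [hdiff, map_div₀, hQT, div_one, map_mul]
  calc _ ≤ exp (-(e : ℤ)) * exp (-3) := mul_le_mul' hT hD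
    _ = _ := by rw [← exp_add]; congr 1; push_cast; ring

/-- **LEMMA 4 (iii), DIGIT-LOCALITY of the weight**: `v(u(j') − u(j)) ≤ exp(−e)` whenever `p^e ∣ j − j'`
(`p ≥ 5`, `2B ≤ A`). -/
theorem padicValuation_phiWeight_sub_le (hp3 : 3 < p) {A B : ℕ} (hAB : 2 * B ≤ A) (n : ℕ) {j j' : ℤ} {e : ℕ}
    (he : (p : ℤ) ^ e ∣ j - j') :
    Rat.padicValuation p (phiWeight A B p n j' - phiWeight A B p n j) ≤ exp (-(e : ℤ)) := by
  have hp : p.Prime := Fact.out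
  have hp2 : p ≠ 2 := by omega
  rw [phiWeight, phiWeight, ← sub_div, sub_sub_sub_cancel_right, phiCoeff_zero hp hp2, phiCoeff_zero hp hp2,
    map_div₀, map_pow, Rat.padicValuation_self, ← exp_nsmul, div_eq_mul_inv, ← exp_neg]
  calc _ ≤ exp (-((e + 3 : ℕ) : ℤ)) * exp (-(3 • (-1 : ℤ))) :=
        mul_le_mul' (padicValuation_brickPhi_sub_le hp3 hAB n he) le_rfl
    _ = exp (-(e : ℤ)) := by rw [← exp_add]; congr 1; push_cast; ring

end

end Summit.KontsevichZagierPeriods.Zeta5Search.BrickWeightLocality
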